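import Summits.QuantumFields.YangMills.Theorems.BalabanUVNodesN18AtReadingOnTables
import Literature.MathematicalPhysics.QuantumFieldTheory.Balaban1983to89.BlockAveragingEMLProp2

/-!
# BalabanUVNodes ∕ node N18 = NE5 — THE TRANSPORT CLAUSE OF THE ADMISSIBLE READING DISCHARGED FOR THE PLAQUETTE-SMALL TABLES: N18's statement of
# record at the ε-small fields, with dag-n18-d's transport of record and NO transport clause (Track A, DAG node N18 = `T4OutputRate.NE5` :211; cluster K4
# «SpineRates», item K3′ `SpineGivenEndpointR12`; module 13 of seat pub-ymgap-dag-n18-d, strategy s2)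

HONEST FRAMING.  Count-neutral kernel bookkeeping (`--supports stmt-QuantumFields-19908 --as helper`), composition BY NAME of landed theorems; NE5 is NOT
PRINTED and NOT proved; N18 is NOT discharged; no inhabitant of `IsDatumOfRecord₁₂C` is claimed (K0′).

WHY.  The admissible reading of record (`Node00/RateRecordW1MapsAdm`, p481475: `ReadingData.ofRecordAdm F M N S sp gauge hg T₀ hT₀ li`) restricts the run
backgrounds to the gauge fields READ INSIDE a space-table family `sp` and carries ONE displayed parameter about the transport: `hT₀` — «`T₀ k` maps the fields of
the `(k+1)`-th torus read inside `sp (k+1)` to fields of the `k`-th torus read inside `sp k`» ([I] (0.21)–(0.22) ∕ [Balaban1985Averaging] content; module 12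
`…N18AtReadingOnTables` §4 takes it as `hTr` for the transport of record).  For ONE honest table family it is a THEOREM of the tree: the PLAQUETTE-SMALL tables —
the print's own small-field condition [I] (0.18) p. 255 ∕ p. 259 «|∂V − 1| < ε₀» (`Balaban1983to89.PlaqSmall`), with a threshold `a k` per torus — because the
transport of record `transportRaw F k (avOfRecord F N (k+1) 0)` IS the (0.4) block averaging `blockAvg expMeanLogSU` (`Node00.avOfRecord_apply`) followed by the
lattice identification `T4LevelShift.fieldShift`, and the tree holds [Balaban1985Averaging] Prop 1 in crude form for that averaging:
`BlockAveragingPlaquetteBound.plaqSmall_blockAvg_expMeanLogSU` — `PlaqSmall a U ⇒ PlaqSmall ((L² + 6((d+2)L)²)·a) (blockAvg ℰp U)` under `0 ≤ a` and the chart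
guard `(((d+2)L)²∕4)·a < δ_N` —, and in SHARP form (dag-n21-c g2's `BlockAveragingEMLProp2.plaqSmall_blockAvg_eml_sharp`: `L²a + 143·((((d+4)L)²∕4)·a)²`, [B7]
(51)'s `L²α₀ + C₀(L²α₀)²`).  So with thresholds obeying the corresponding STEP LAW per torus the clause holds.

WHAT.
* §1 the T4 lattice identification preserves plaquette variables: `plaqHol_fieldShift₄` (twin of `T3LevelShift.plaqHol_fieldShift`), `plaqSmall_fieldShift₄`,
  `plaqSmall_transportRaw`.
* §2 `plaqSmall_transportRaw_avOfRecord` — Prop 1 for the transport of record: `PlaqSmall a U ⇒ PlaqSmall ((L² + 6((d+2)L)²)·a) (transportRaw F k (avOfRecord F N (k+1) 0) U)`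
  (crude, chart guard `(((d+2)L)²∕4)·a < δ_N`), and `plaqSmall_transportRaw_avOfRecord_sharp` — the print's `L²a + C₀(L²a)²` from dag-n21-c g2's SHARP Prop 1
  `BlockAveragingEMLProp2.plaqSmall_blockAvg_eml_sharp` (guard `(((d+4)L)²∕4)·a ≤ δ_N∕2`).
* §3 `ofBackgroundC_ιSU_injective` (the reading `U ↦ (ιU, 0)` is injective), `mem_image_ofBackgroundC_iff`.
* §4 THE PLAQUETTE-SMALL TABLE FAMILY (a displayed lambda — `(k, j, Y) ↦ (ι·, 0) '' {V | PlaqSmall (a F θ k) V}`, constant in `(j, Y)`) and THE CLAUSE `hT₀` FOR IT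
  at the transport of record, TWICE: ★ `admTransport_plaqSmall` (crude step law `(L² + 6((d+2)L)²)·a (k+1) ≤ a k`) and ★ `admTransport_plaqSmall_sharp` (the print's
  step law `L²·a (k+1) + C₀(L²·a (k+1))² ≤ a k`, `C₀` in the tree's numerals).
* §5 N18 at the admissible reading ON THE PLAQUETTE-SMALL TABLES with the transport of record, for ANY proof `hT` of the clause (§4 gives two; by proof
  irrelevance the reading does not depend on which): ★ `s_N18_readingAdmPlaqSmall₁₂_iff` (closed form: the two-run inequality for every `U` with
  `PlaqSmall (a F θ (k+1)) U` — the statement of record AT THE ε-SMALL FIELDS), ★ `s_N18_readingAdmPlaqSmall₁₂_of_ofRecord` (module 10's all-fields statement of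
  record ⇒ this one; module 12 §4), `admBg_plaqSmall_nonempty` (positive thresholds ⇒ `U ≡ 1` is admissible — the A1 hook `AdmBg.nonempty_of_mem`).
* §6 ★ `s_N18_readingAdmPlaqSmall₁₂_of_envelope_bound238` — THE ROW AT THE ε-SMALL FIELDS: module 12 §3 at these tables (clause `hT` from §4) with the
  restriction clauses `SpRestr` DISCHARGED (the tables are constant in the domain): END data + `AnalyticH`∕`Bound238` of the towers on the plaquette-small
  tables ⇒ `S_N18` — no embedding ∕ pairing ∕ restriction clause; the transport clause is §4's theorem.
What REMAINS displayed for N18 at these tables: the END's data-direction datum and leaves, and `AnalyticH` + `Bound238` of the towers of record ON THE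
PLAQUETTE-SMALL TABLES (their inclusion in the analyticity domains `U^c_j(X, α₀, α₁)` — [I] (1.11)–(1.16) — is NODE 00 ∕ N03 content, asserted nowhere here);
the crude constant `L² + 6((d+2)L)²` replaces the print's `O(L²)`.  One finite four-torus programme at fixed `ε`; NOT the continuum limit, NOT OS, NOT a mass gap,
NOT Clay.  0 `def`, 0 `sorry`.  Sources (TYPES only): T. Bałaban, CMP **98** (1985) [Balaban1985Averaging] Prop. 1 (51) p. 26; CMP **109** (1987) [Balaban1987RG1]
(0.4) p. 253, (0.18) p. 255, (0.21)–(0.25) pp. 256–257, p. 259, Thm 1 p. 259, (1.11)–(1.16) p. 262, (1.18) p. 263; CMP **116** (1988) [Balaban1988RG2Cluster]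
(2.13) p. 14, (2.16)–(2.18) p. 16.
-/

noncomputable section

open Set Metric
open scoped Matrix.Norms.L2Operator

namespace YMDAG.N18.W1Reading

open Literature.MathematicalPhysics.QuantumFieldTheory.Balaban1983to89
open Literature.MathematicalPhysics.QuantumFieldTheory.Balaban1983to89.T4Continuum
open Literature.MathematicalPhysics.QuantumFieldTheory.Balaban1983to89.T4OutputRate (Window)
open Literature.MathematicalPhysics.QuantumFieldTheory.Balaban1983to89.T4InputCauchyRateData (StepModel)
open Literature.MathematicalPhysics.QuantumFieldTheory.Balaban1983to89.B13Resummation (locE)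
open Literature.MathematicalPhysics.QuantumFieldTheory.Balaban1983to89.TreeLengthTorus (TDom tsys torusTreeLen)
open Literature.MathematicalPhysics.QuantumFieldTheory.Balaban1983to89.TreeLengthTorusGeometry (TTouch)
open Literature.MathematicalPhysics.QuantumFieldTheory.Balaban1983to89.B12TreeDecay (K₀)
open Literature.MathematicalPhysics.QuantumFieldTheory.Balaban1983to89.T4LevelShift (fieldShift bondShift siteShift siteShift_shift fieldShift_apply)
open Literature.MathematicalPhysics.QuantumFieldTheory.Balaban1983to89.ExpMeanLog (deltaSU expMeanLogSU)
open Literature.MathematicalPhysics.QuantumFieldTheory.Balaban1983to89.BlockAveraging (blockAvg)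
open Literature.MathematicalPhysics.QuantumFieldTheory.Balaban1983to89.BlockAveragingPlaquetteBound (plaqSmall_blockAvg_expMeanLogSU)
open Literature.MathematicalPhysics.QuantumFieldTheory.Balaban1983to89.BlockAveragingEMLProp2 (plaqSmall_blockAvg_eml_sharp)
open Literature.MathematicalPhysics.QuantumFieldTheory.Balaban1983to89.Node00 (Stage12Params IsDatumOfRecord₁₂C NE2Objects₁₁ NE3Letters₁₁ prependCoupling
  MatA ιSU coe_ιSU avOfRecord avOfRecord_apply)
open Literature.MathematicalPhysics.QuantumFieldTheory.Balaban1983to89.Node00.Sect2 (domCount domSys CPair ofBackgroundC cubeDom)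
open Literature.MathematicalPhysics.QuantumFieldTheory.Balaban1983to89.Node00.W1 (ReadingData LevelPairing LetterInputs ClusterTower pairOfRecord functionalC
  AdmBg box)
open Summit.QuantumFields.BalabanUV.T4Continuum.B13Carriers (transportRaw sitesPerDir_runA_zero)
open Summit.QuantumFields.BalabanUV.T4Continuum.Spine.NE5
open YMDAG.N18.HLayer
open YMDAG.UVSplit

variable {N : ℕ} [NeZero N]

/-! ## §1 The T4 lattice identification preserves plaquette variables -/

section Shift

variable {F : T4Family} {G : Type*} [GaugeGroup G] {K j K' j' : ℕ}

omit [NeZero N] in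
/-- **PLAQUETTE VARIABLES CORRESPOND UNDER THE LEVEL IDENTIFICATION** (T4 twin of `T3LevelShift.plaqHol_fieldShift`): `U(∂p)` of `fieldShift h V` is
`U(∂p′)` of `V` at the plaquette `p′` with corner `siteShift h p.src` and the same directions. [cite: Balaban1987RG1, (0.2) p.252 (bookkeeping)] -/
theorem plaqHol_fieldShift₄ (h : (F.P K).sitesPerDir j = (F.P K').sitesPerDir j') (V : GaugeField (F.P K') j' G) (p : Plaq (F.P K) j) :
    GaugeField.plaqHol (fieldShift h V) p = GaugeField.plaqHol V ⟨siteShift h p.src, p.μ, p.ν, p.hμν⟩ := by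
  simp only [GaugeField.plaqHol, fieldShift_apply]
  show V ⟨siteShift h p.src, p.μ⟩ * V ⟨siteShift h (p.src.shift p.μ), p.ν⟩ * (V ⟨siteShift h (p.src.shift p.ν), p.μ⟩)⁻¹ *
      (V ⟨siteShift h p.src, p.ν⟩)⁻¹ = _
  rw [siteShift_shift, siteShift_shift]

omit [NeZero N] in
/-- **PLAQUETTE-SMALLNESS IS PRESERVED BY THE LEVEL IDENTIFICATION**: `PlaqSmall δ V → PlaqSmall δ (fieldShift h V)`. [cite: Balaban1987RG1, (0.18) p.255 (bookkeeping)] -/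
theorem plaqSmall_fieldShift₄ (h : (F.P K).sitesPerDir j = (F.P K').sitesPerDir j') {V : GaugeField (F.P K') j' G} {δ : ℝ} (hV : PlaqSmall δ V) :
    PlaqSmall δ (fieldShift h V) := fun p => by
  rw [plaqHol_fieldShift₄ h V p]
  exact hV _

omit [NeZero N] in
/-- **PLAQUETTE-SMALLNESS PASSES THROUGH dag-n18-d's RAW TRANSPORT** `transportRaw F K av = fieldShift ∘ av.avg`: if the averaged field `av.avg U` (level 1 of
the `(K+1)`-th torus) is `δ`-plaquette-small, so is the transported field (level 0 of the `K`-th torus). [cite: Balaban1987RG1, (0.4) p.253 and (0.18) p.255 (bookkeeping)] -/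
theorem plaqSmall_transportRaw (K : ℕ) (av : Averaging (F.P (K + 1)) 0 G) {U : GaugeField (F.P (K + 1)) 0 G} {δ : ℝ} (hU : PlaqSmall δ (av.avg U)) :
    PlaqSmall δ (transportRaw F K av U) :=
  plaqSmall_fieldShift₄ (sitesPerDir_runA_zero F K) hU

end Shift

/-! ## §2 [Balaban1985Averaging] Prop 1 for the transport of record -/

/-- **ε-SMALL FIELDS ARE TRANSPORTED TO `(L² + 6((d+2)L)²)·ε`-SMALL FIELDS BY THE TRANSPORT OF RECORD** [bookkeeping; the tree's crude Prop 1
`BlockAveragingPlaquetteBound.plaqSmall_blockAvg_expMeanLogSU` for the (0.4) averaging with `exp[mean log]` on `SU(N)` + `Node00.avOfRecord_apply` + §1]: for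
`0 ≤ a` under the chart guard `(((d+2)L)²∕4)·a < δ_N` (`d = 4`, `L = F.L`), `PlaqSmall a U ⇒ PlaqSmall ((L² + 6((d+2)L)²)·a) (transportRaw F k (avOfRecord F N (k+1) 0) U)`.
[cite: Balaban1985Averaging, Prop. 1 (51) p.26; Balaban1987RG1, (0.4) p.253 and (0.18) p.255] -/
theorem plaqSmall_transportRaw_avOfRecord {F : T4Family} (k : ℕ) {a : ℝ} (ha : 0 ≤ a)
    (hguard : ((((F.P (k + 1)).d + 2) * (F.P (k + 1)).L : ℕ) : ℝ) ^ 2 / 4 * a < deltaSU (Fin N)) {U : GaugeField (F.P (k + 1)) 0 (Node00.SU N)}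
    (hU : PlaqSmall a U) :
    PlaqSmall ((((F.P (k + 1)).L : ℝ) ^ 2 + 6 * ((((F.P (k + 1)).d + 2) * (F.P (k + 1)).L : ℕ) : ℝ) ^ 2) * a)
      (transportRaw F k (avOfRecord F N (k + 1) 0) U) := by
  refine plaqSmall_transportRaw k (avOfRecord F N (k + 1) 0) ?_
  have hj : 0 + 1 ≤ (F.P (k + 1)).m + (F.P (k + 1)).K := by simp only [T4Family.P_K]; omega
  rw [avOfRecord_apply]
  exact plaqSmall_blockAvg_expMeanLogSU (n := Fin N) hj ha hU hguard

/-- **THE SAME WITH THE PRINT's CONSTANT** [bookkeeping; dag-n21-c g2's SHARP Prop 1 for (0.4), `BlockAveragingEMLProp2.plaqSmall_blockAvg_eml_sharp`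
(second order, no range hypothesis)]: for `0 < a` under `(((d+4)L)²∕4)·a ≤ δ_N∕2`, `PlaqSmall a U ⇒ PlaqSmall (L²a + 143·((((d+4)L)²∕4)·a)²) (transportRaw F k (avOfRecord F N (k+1) 0) U)`
— [B7] (51) `|V̄(∂p′) − 1| < L²α₀ + C₀(L²α₀)²`. [cite: Balaban1985Averaging, Prop. 1 (51) p.26; Balaban1987RG1, (0.4) p.253 and (0.18) p.255] -/
theorem plaqSmall_transportRaw_avOfRecord_sharp {F : T4Family} (k : ℕ) {a : ℝ} (ha : 0 < a)
    (hguard : ((((F.P (k + 1)).d + 4) * (F.P (k + 1)).L : ℕ) : ℝ) ^ 2 / 4 * a ≤ deltaSU (Fin N) / 2) {U : GaugeField (F.P (k + 1)) 0 (Node00.SU N)}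
    (hU : PlaqSmall a U) :
    PlaqSmall (((F.P (k + 1)).L : ℝ) ^ 2 * a + 143 * (((((F.P (k + 1)).d + 4) * (F.P (k + 1)).L : ℕ) : ℝ) ^ 2 / 4 * a) ^ 2)
      (transportRaw F k (avOfRecord F N (k + 1) 0) U) := by
  refine plaqSmall_transportRaw k (avOfRecord F N (k + 1) 0) ?_
  rw [avOfRecord_apply]
  exact plaqSmall_blockAvg_eml_sharp (n := Fin N) ha hU hguard

/-! ## §3 The reading `U ↦ (ιU, 0)` is injective -/

omit [NeZero N] in
/-- **THE READING OF A GAUGE FIELD IN `Φ` DETERMINES IT**: `U ↦ (ιU, 0)` (`Sect2.ofBackgroundC (ιSU N)`) is injective (`ιSU` is the matrix inclusion).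
[cite: Balaban1987RG1, pp.251–252 and (1.9) pp.261–262 (bookkeeping)] -/
theorem ofBackgroundC_ιSU_injective {P : Params} : Function.Injective (ofBackgroundC (P := P) (ιSU N)) := by
  intro U V h
  funext b
  have hb := congrFun (congrArg Prod.fst h) b
  have hb' : ((U b : Node00.SU N) : MatA N) = ((V b : Node00.SU N) : MatA N) := by
    simpa only [ofBackgroundC, coe_ιSU] using hb
  exact Subtype.ext hb'

omit [NeZero N] in
/-- **A FIELD IS READ INSIDE THE IMAGE OF A SET OF FIELDS IFF IT BELONGS TO THE SET** (injectivity of the reading). [cite: Balaban1987RG1, (1.9) pp.261–262 (bookkeeping)] -/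
theorem mem_image_ofBackgroundC_iff {P : Params} (A : Set (GaugeField P 0 (Node00.SU N))) (U : GaugeField P 0 (Node00.SU N)) :
    ofBackgroundC (ιSU N) U ∈ ofBackgroundC (ιSU N) '' A ↔ U ∈ A :=
  ofBackgroundC_ιSU_injective.mem_set_image

/-! ## §4 The plaquette-small table family and its transport clause at the transport of record -/

section Tables

variable (a : (F : T4Family) → Stage12Params F N → ℕ → ℝ)

/-- **THE TRANSPORT CLAUSE `hT₀` OF THE ADMISSIBLE READING HOLDS FOR THE PLAQUETTE-SMALL TABLE FAMILY AT THE TRANSPORT OF RECORD** [bookkeeping; §2 + §3].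
The table family (DISPLAYED, a lambda): on the `k`-th torus, at every creation step `j` and domain `Y`, the readings `(ιV, 0)` of the gauge fields `V` with
`PlaqSmall (a F θ k) V` — [I] (0.18) p. 255 ∕ p. 259 «|∂V − 1| < ε₀», thresholds `a F θ k` per torus.  Under `0 ≤ a F θ (k+1)`, the STEP LAW
`(L² + 6((d+2)L)²)·a F θ (k+1) ≤ a F θ k` and the chart guard `(((d+2)L)²∕4)·a F θ (k+1) < δ_N`: every field of the `(k+1)`-th torus read inside the family is
transported by `transportRaw F k (avOfRecord F N (k+1) 0)` to a field of the `k`-th torus read inside it — the argument `hT₀` of `ReadingData.ofRecordAdm`.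
[cite: Balaban1985Averaging, Prop. 1 (51) p.26; Balaban1987RG1, (0.4) p.253, (0.18) p.255 and (0.21)–(0.22) p.256] -/
theorem admTransport_plaqSmall (ha : ∀ (F : T4Family) (θ : Stage12Params F N) (k : ℕ), 0 ≤ a F θ (k + 1))
    (hstep : ∀ (F : T4Family) (θ : Stage12Params F N) (k : ℕ),
      (((F.P (k + 1)).L : ℝ) ^ 2 + 6 * ((((F.P (k + 1)).d + 2) * (F.P (k + 1)).L : ℕ) : ℝ) ^ 2) * a F θ (k + 1) ≤ a F θ k)
    (hguard : ∀ (F : T4Family) (θ : Stage12Params F N) (k : ℕ),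
      ((((F.P (k + 1)).d + 2) * (F.P (k + 1)).L : ℕ) : ℝ) ^ 2 / 4 * a F θ (k + 1) < deltaSU (Fin N))
    (F : T4Family) (θ : Stage12Params F N) (k : ℕ) (U : GaugeField (F.P (k + 1)) 0 (Node00.SU N))
    (hU : ∀ (j : ℕ) (Y : (domSys (F.P (k + 1)) θ.τ9.M j).Dom),
      ofBackgroundC (ιSU N) U ∈ (fun (k j : ℕ) (_ : (domSys (F.P k) θ.τ9.M j).Dom) =>
        ofBackgroundC (ιSU N) '' {V : GaugeField (F.P k) 0 (Node00.SU N) | PlaqSmall (a F θ k) V}) (k + 1) j Y)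
    (j : ℕ) (X : (domSys (F.P k) θ.τ9.M j).Dom) :
    ofBackgroundC (ιSU N) (transportRaw F k (avOfRecord F N (k + 1) 0) U) ∈
      (fun (k j : ℕ) (_ : (domSys (F.P k) θ.τ9.M j).Dom) =>
        ofBackgroundC (ιSU N) '' {V : GaugeField (F.P k) 0 (Node00.SU N) | PlaqSmall (a F θ k) V}) k j X := by
  have hsmall : PlaqSmall (a F θ (k + 1)) U :=
    (mem_image_ofBackgroundC_iff _ U).1 (hU 0 (cubeDom (F.P (k + 1)) θ.τ9.M 0 fun _ => 0))
  refine (mem_image_ofBackgroundC_iff _ _).2 fun p => ?_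
  exact (plaqSmall_transportRaw_avOfRecord k (ha F θ k) (hguard F θ k) hsmall p).trans_le (hstep F θ k)

/-- **THE TRANSPORT CLAUSE WITH THE PRINT's STEP LAW** [bookkeeping; §2's sharp form]: under `0 < a F θ (k+1)`, the step law
`L²·a F θ (k+1) + 143·((((d+4)L)²∕4)·a F θ (k+1))² ≤ a F θ k` ([B7] (51): `L²α₀ + C₀(L²α₀)²`) and the guard `(((d+4)L)²∕4)·a F θ (k+1) ≤ δ_N∕2`, the clause `hT₀` of
`ReadingData.ofRecordAdm` for the plaquette-small table family at the transport of record. [cite: Balaban1985Averaging, Prop. 1 (51) p.26; Balaban1987RG1, (0.4) p.253, (0.18) p.255 and (0.21)–(0.22) p.256] -/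
theorem admTransport_plaqSmall_sharp (ha : ∀ (F : T4Family) (θ : Stage12Params F N) (k : ℕ), 0 < a F θ (k + 1))
    (hstep : ∀ (F : T4Family) (θ : Stage12Params F N) (k : ℕ),
      ((F.P (k + 1)).L : ℝ) ^ 2 * a F θ (k + 1) + 143 * (((((F.P (k + 1)).d + 4) * (F.P (k + 1)).L : ℕ) : ℝ) ^ 2 / 4 * a F θ (k + 1)) ^ 2 ≤ a F θ k)
    (hguard : ∀ (F : T4Family) (θ : Stage12Params F N) (k : ℕ),
      ((((F.P (k + 1)).d + 4) * (F.P (k + 1)).L : ℕ) : ℝ) ^ 2 / 4 * a F θ (k + 1) ≤ deltaSU (Fin N) / 2)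
    (F : T4Family) (θ : Stage12Params F N) (k : ℕ) (U : GaugeField (F.P (k + 1)) 0 (Node00.SU N))
    (hU : ∀ (j : ℕ) (Y : (domSys (F.P (k + 1)) θ.τ9.M j).Dom),
      ofBackgroundC (ιSU N) U ∈ (fun (k j : ℕ) (_ : (domSys (F.P k) θ.τ9.M j).Dom) =>
        ofBackgroundC (ιSU N) '' {V : GaugeField (F.P k) 0 (Node00.SU N) | PlaqSmall (a F θ k) V}) (k + 1) j Y)
    (j : ℕ) (X : (domSys (F.P k) θ.τ9.M j).Dom) :
    ofBackgroundC (ιSU N) (transportRaw F k (avOfRecord F N (k + 1) 0) U) ∈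
      (fun (k j : ℕ) (_ : (domSys (F.P k) θ.τ9.M j).Dom) =>
        ofBackgroundC (ιSU N) '' {V : GaugeField (F.P k) 0 (Node00.SU N) | PlaqSmall (a F θ k) V}) k j X := by
  have hsmall : PlaqSmall (a F θ (k + 1)) U :=
    (mem_image_ofBackgroundC_iff _ U).1 (hU 0 (cubeDom (F.P (k + 1)) θ.τ9.M 0 fun _ => 0))
  refine (mem_image_ofBackgroundC_iff _ _).2 fun p => ?_
  exact (plaqSmall_transportRaw_avOfRecord_sharp k (ha F θ k) (hguard F θ k) hsmall p).trans_le (hstep F θ k)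

/-- **POSITIVE THRESHOLDS MAKE THE PLAQUETTE-SMALL TABLES INHABITED**: the unit configuration `U ≡ 1` (all plaquette variables `= 1`) is read inside every entry,
so the admissible backgrounds `AdmBg` of the `k`-th torus are NON-EMPTY (node00-def-W1 g4's hook `AdmBg.nonempty_of_mem`) — the A1 converse of module 12 §5.
[cite: Balaban1987RG1, (0.18) p.255 and (1.11)–(1.16) p.262 (bookkeeping; non-vacuity)] -/
theorem admBg_plaqSmall_nonempty (F : T4Family) (θ : Stage12Params F N) (k : ℕ) (hpos : 0 < a F θ k) :
    Nonempty (AdmBg F θ.τ9.M N (fun (k j : ℕ) (_ : (domSys (F.P k) θ.τ9.M j).Dom) =>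
      ofBackgroundC (ιSU N) '' {V : GaugeField (F.P k) 0 (Node00.SU N) | PlaqSmall (a F θ k) V}) k) := by
  refine AdmBg.nonempty_of_mem F θ.τ9.M N (1 : GaugeField (F.P k) 0 (Node00.SU N)) fun j Y => (mem_image_ofBackgroundC_iff _ _).2 fun p => ?_
  have h1 : GaugeField.plaqHol (1 : GaugeField (F.P k) 0 (Node00.SU N)) p = 1 := by
    simp [GaugeField.plaqHol, show ∀ b : PBond (F.P k) 0, (1 : GaugeField (F.P k) 0 (Node00.SU N)) b = 1 from fun _ => rfl]
  rw [h1, GaugeGroup.dist1_one]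
  exact hpos

end Tables

/-! ## §5 N18 at the admissible reading on the plaquette-small tables, transport of record, NO transport clause -/

section Record

variable (S : (F : T4Family) → (θ : Stage12Params F N) → (k : ℕ) → ClusterTower (F.P k) (MatA N) θ.τ9.M)
  (a : (F : T4Family) → Stage12Params F N → ℕ → ℝ)
  (hT : ∀ (F : T4Family) (θ : Stage12Params F N) (k : ℕ) (U : GaugeField (F.P (k + 1)) 0 (Node00.SU N)),
    (∀ (j : ℕ) (Y : (domSys (F.P (k + 1)) θ.τ9.M j).Dom),
      ofBackgroundC (ιSU N) U ∈ (fun (k j : ℕ) (_ : (domSys (F.P k) θ.τ9.M j).Dom) =>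
        ofBackgroundC (ιSU N) '' {V : GaugeField (F.P k) 0 (Node00.SU N) | PlaqSmall (a F θ k) V}) (k + 1) j Y) →
      ∀ (j : ℕ) (X : (domSys (F.P k) θ.τ9.M j).Dom),
        ofBackgroundC (ιSU N) (transportRaw F k (avOfRecord F N (k + 1) 0) U) ∈
          (fun (k j : ℕ) (_ : (domSys (F.P k) θ.τ9.M j).Dom) =>
            ofBackgroundC (ιSU N) '' {V : GaugeField (F.P k) 0 (Node00.SU N) | PlaqSmall (a F θ k) V}) k j X)
  (gauge : (F : T4Family) → (θ : Stage12Params F N) → (k : ℕ) → GaugeField (F.P k) 0 (Node00.SU N) → GaugeField (F.P k) 0 (Node00.SU N) → ℝ)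
  (hg : ∀ (F : T4Family) (θ : Stage12Params F N) (k : ℕ) (U U' : GaugeField (F.P k) 0 (Node00.SU N)), 0 ≤ gauge F θ k U U')
  (li : (F : T4Family) → Stage12Params F N → LetterInputs) (ℓ₃ : T4Family → NE3Letters₁₁)
  (ne2 : (F : T4Family) → Stage12Params F N → (ℕ → ℝ) → List (ULoop F) → ℕ → NE2Objects₁₁)
  (ne1 : (F : T4Family) → Stage12Params F N → (ℕ → ℝ) → List (ULoop F) → NE1pCarriers)

/-- **N18's STATEMENT OF RECORD AT THE ε-SMALL FIELDS, IN CLOSED FORM** [bookkeeping; module 12 §2 `s_N18_readingAdm₁₂_iff` at the plaquette-small tables + §3's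
injectivity of the reading]: at the admissible reading of record on the plaquette-small tables with the transport of record (clause `hT`: §4's `admTransport_plaqSmall`
or `admTransport_plaqSmall_sharp` — the reading is the same term for any proof),
`S_N18 (RRec₁₂ 𝔯)` ⇔ for every family `F`, datum key `h` (`θ := h.params`), run length `k`, member `b ∈ ]0, θ.γ]`, history `g ∈ ]0, θ.γ]^ℕ`, every gauge field `U`
of the `(k+1)`-th torus with `PlaqSmall (a F θ (k+1)) U` («|∂U − 1| < a_{k+1}», [I] (0.18)) and every run-A domain `(j, X)`:
`|Re E^{(j)}_{S_k}(X; g; (ι(M U), 0)) − Re E^{(j+1)}_{S_{k+1}}(πX; b∷g; (ιU, 0))| ≤ C₅ · θ₅ ^ j · e^{−κ·d_j(X)}`, `M U` the transport of record.  NOT PRINTED; NOT proved.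
[cite: Balaban1987RG1, (0.4) p.253, (0.18) p.255, (0.24)–(0.25) p.257, Thm 1 p.259 and (1.18) p.263; Balaban1988RG2Cluster, (2.13) p.14] -/
theorem s_N18_readingAdmPlaqSmall₁₂_iff :
    S_N18 (RRec₁₂ (readingOfRecord₁₂ (fun F θ => ReadingData.ofRecordAdm F θ.τ9.M N (S F θ)
      (fun (k j : ℕ) (_ : (domSys (F.P k) θ.τ9.M j).Dom) => ofBackgroundC (ιSU N) '' {V : GaugeField (F.P k) 0 (Node00.SU N) | PlaqSmall (a F θ k) V})
      (gauge F θ) (hg F θ) (fun k => transportRaw F k (avOfRecord F N (k + 1) 0)) (hT F θ) (li F θ)) ℓ₃ ne2 ne1)) ↔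
      ∀ (F : T4Family) (D : Datum F N) (h : IsDatumOfRecord₁₂C F N D) (k : ℕ) (b : ℝ), 0 < b → b ≤ h.params.γ →
        ∀ g ∈ Window h.params.γ, ∀ (U : GaugeField (F.P (k + 1)) 0 (Node00.SU N)), PlaqSmall (a F h.params (k + 1)) U →
          ∀ X : Node00.W1.Dom (F.P k) h.params.τ9.M,
          |(functionalC (S F h.params k) g (ofBackgroundC (ιSU N) (transportRaw F k (avOfRecord F N (k + 1) 0) U)) X).re -
              (functionalC (S F h.params (k + 1)) (prependCoupling b g) (ofBackgroundC (ιSU N) U) (pairOfRecord F h.params.τ9.M k X)).re| ≤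
            (li F h.params).C₅ * (li F h.params).θ₅ ^ X.1 * Real.exp (-((li F h.params).κ * (domSys (F.P k) h.params.τ9.M X.1).dj X.2)) := by
  rw [s_N18_readingAdm₁₂_iff]
  refine ⟨fun H F D h k b hb hbγ g hgW U hU X => ?_, fun H F D h k b hb hbγ g hgW U X => ?_⟩
  · exact H F D h k b hb hbγ g hgW ⟨U, fun j Y => (mem_image_ofBackgroundC_iff _ U).2 hU⟩ X
  · exact H F D h k b hb hbγ g hgW U.1
      ((mem_image_ofBackgroundC_iff _ U.1).1 (U.2 0 (cubeDom (F.P (k + 1)) h.params.τ9.M 0 fun _ => 0))) X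

/-- **MODULE 10's ALL-FIELDS STATEMENT OF RECORD IMPLIES N18's STATEMENT AT THE ε-SMALL FIELDS** [bookkeeping; module 12 §4 `s_N18_readingAdmOfRecord₁₂_of_ofRecord`
with `hTr := hT`, §4's clause — e.g. `admTransport_plaqSmall a ha hstep hguard`: then the thresholds' sign, step law and chart guard are the only side conditions].
[cite: Balaban1985Averaging, Prop. 1 (51) p.26; Balaban1987RG1, (0.4) p.253, (0.18) p.255, Thm 1 p.259 and (1.18) p.263] -/
theorem s_N18_readingAdmPlaqSmall₁₂_of_ofRecord
    (hS : S_N18 (RRec₁₂ (readingOfRecord₁₂ (fun F θ => ReadingData.ofRecord F θ.τ9.M N (S F θ) (gauge F θ) (hg F θ)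
      (fun k => transportRaw F k (avOfRecord F N (k + 1) 0)) (li F θ)) ℓ₃ ne2 ne1))) :
    S_N18 (RRec₁₂ (readingOfRecord₁₂ (fun F θ => ReadingData.ofRecordAdm F θ.τ9.M N (S F θ)
      (fun (k j : ℕ) (_ : (domSys (F.P k) θ.τ9.M j).Dom) => ofBackgroundC (ιSU N) '' {V : GaugeField (F.P k) 0 (Node00.SU N) | PlaqSmall (a F θ k) V})
      (gauge F θ) (hg F θ) (fun k => transportRaw F k (avOfRecord F N (k + 1) 0)) (hT F θ) (li F θ)) ℓ₃ ne2 ne1)) :=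
  s_N18_readingAdmOfRecord₁₂_of_ofRecord S _ gauge hg li ℓ₃ ne2 ne1 hT hS

/-! ## §6 The row at the ε-small fields: module 12 §3 with the transport clause AND the restriction clauses discharged -/

open Classical in
/-- **THE ROW AT THE ε-SMALL FIELDS** [bookkeeping; module 12 §3 `s_N18_readingAdm₁₂_of_envelope_bound238` at the plaquette-small tables with the transport of
record: clause `hT` from §4, and the restriction-closedness clauses `SpRestr` TRIVIAL (the tables are constant in the domain)].  If at EVERY admissible
Stage-12 tuple with provisos and every run length there are (i) the END's data over the carriers of the admissible pairing ON THE PLAQUETTE-SMALL TABLES (per-member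
step models representing (2.13) with THE NODE-A MAJORANT AS HYPOTHESIS, L01–L03, L07–L09*, numerals, L10, sharp clause) and (ii) `AnalyticH` + `Bound238` of the
towers of record `S F θ k ∕ (k+1)` at every step ON THE PLAQUETTE-SMALL TABLES of the two tori (amplitudes `A_A ∕ A_B`, the END's rate, STRICT [KP86] clauses), the
letters dominating — then `S_N18` at the admissible reading on the plaquette-small tables with the transport of record.  NO embedding clause, NO pairing clause, NO
restriction clause; the transport clause is §4's theorem.  What (ii) asks of NODE A ∕ N10 is (2.13an) + (2.38) for the (2.14) terms AT THE ε-SMALL REAL FIELDS — inside the print's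
`U^c_j(X, α₀, α₁)` by [I] (1.11)–(1.16), an inclusion asserted nowhere here. [cite: Balaban1988RG2Cluster, (2.13) p.14, p.15, (2.16)–(2.18) p.16 and Lemma 3 (2.38) p.20; Balaban1987RG1, (0.18) p.255, (0.24)–(0.25) p.257, (1.11)–(1.16) p.262, (1.18) p.263 and Thm 1 p.259; Balaban1985Averaging, Prop. 1 (51) p.26] -/
theorem s_N18_readingAdmPlaqSmall₁₂_of_envelope_bound238
    (h : ∀ (F : T4Family) (θ : Stage12Params F N), θ.Provisos₁₂ F N → θ.Admissible F N → ∀ k : ℕ,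
      ∃ (Op : Type) (_ : NormedAddCommGroup Op) (_ : NormedSpace ℂ Op) (Hist : Type) (_ : NormedAddCommGroup Hist) (_ : NormedSpace ℂ Hist)
        (Mb : ℝ → StepModel (LevelPairing.ofRecordAdm F θ.τ9.M N k (fun (k j : ℕ) (_ : (domSys (F.P k) θ.τ9.M j).Dom) =>
            ofBackgroundC (ιSU N) '' {V : GaugeField (F.P k) 0 (Node00.SU N) | PlaqSmall (a F θ k) V})
          (gauge F θ k) (hg F θ k) (transportRaw F k (avOfRecord F N (k + 1) 0)) (hT F θ k)).carriers Op Hist)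
        (act : ℝ → (j : ℕ) → Op × Hist → TDom 4 (domCount (F.P k) θ.τ9.M j) → ℂ) (γ' C3 ε₁ Rd κ A_A A_B E₁ δ δ' θr θ' cH ω ρ₀ B : ℝ) (k₀ : ℕ),
        -- (i) the END's data over the carriers of the admissible level pairing
        (∀ b : ℝ, 0 < b → b ≤ γ' → ∀ (X : Node00.W1.Dom (F.P k) θ.τ9.M) (z : Op × Hist),
          (Mb b).Out X.1 z.1 z.2 X =
            locE (TTouch (d := 4) (N := domCount (F.P k) θ.τ9.M X.1)) (fun Z : (tsys 4 (domCount (F.P k) θ.τ9.M X.1)).Dom => Z.1)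
              (act b X.1 z) X.2.1) ∧
        0 ≤ C3 ∧ 0 ≤ ε₁ ∧ 0 ≤ κ ∧ κ + 2 * (64 * Real.log 162) + 2 ≤ Rd ∧
        C3 * ε₁ * Real.exp (5 * κ + 1) * K₀ 64 8 * 9 * 64 ≤ 1 ∧
        (∀ b : ℝ, 0 < b → b ≤ γ' → ∀ j, ∀ g ∈ Window γ',
          ∀ (U : (LevelPairing.ofRecordAdm F θ.τ9.M N k (fun (k j : ℕ) (_ : (domSys (F.P k) θ.τ9.M j).Dom) =>
            ofBackgroundC (ιSU N) '' {V : GaugeField (F.P k) 0 (Node00.SU N) | PlaqSmall (a F θ k) V})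
          (gauge F θ k) (hg F θ k) (transportRaw F k (avOfRecord F N (k + 1) 0)) (hT F θ k)).BgB) (q : Op × Hist),
          q ∈ (Mb b).Base j g U →
          ∃ V : Set (Op × Hist), IsOpen V ∧ (Mb b).box j q ⊆ V ∧
            (∀ Z : TDom 4 (domCount (F.P k) θ.τ9.M j), DifferentiableOn ℂ (fun z : Op × Hist => act b j z Z) V) ∧
            (∀ z ∈ V, ∀ Z : TDom 4 (domCount (F.P k) θ.τ9.M j), ‖act b j z Z‖ ≤ C3 * ε₁ * Real.exp (-(Rd * torusTreeLen Z.1)))) ∧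
        (∀ b : ℝ, 0 < b → b ≤ γ' → L01 (Mb b)
          ((LevelPairing.ofRecordAdm F θ.τ9.M N k (fun (k j : ℕ) (_ : (domSys (F.P k) θ.τ9.M j).Dom) =>
            ofBackgroundC (ιSU N) '' {V : GaugeField (F.P k) 0 (Node00.SU N) | PlaqSmall (a F θ k) V})
          (gauge F θ k) (hg F θ k) (transportRaw F k (avOfRecord F N (k + 1) 0)) (hT F θ k)).EA (S F θ k)) (Window γ')) ∧
        (∀ b : ℝ, 0 < b → b ≤ γ' → L02 (Mb b)
          ((LevelPairing.ofRecordAdm F θ.τ9.M N k (fun (k j : ℕ) (_ : (domSys (F.P k) θ.τ9.M j).Dom) =>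
            ofBackgroundC (ιSU N) '' {V : GaugeField (F.P k) 0 (Node00.SU N) | PlaqSmall (a F θ k) V})
          (gauge F θ k) (hg F θ k) (transportRaw F k (avOfRecord F N (k + 1) 0)) (hT F θ k)).EB (S F θ (k + 1)) b)
          (Window γ')) ∧
        (∀ b : ℝ, 0 < b → b ≤ γ' → L03 (Mb b)
          ((LevelPairing.ofRecordAdm F θ.τ9.M N k (fun (k j : ℕ) (_ : (domSys (F.P k) θ.τ9.M j).Dom) =>
            ofBackgroundC (ιSU N) '' {V : GaugeField (F.P k) 0 (Node00.SU N) | PlaqSmall (a F θ k) V})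
          (gauge F θ k) (hg F θ k) (transportRaw F k (avOfRecord F N (k + 1) 0)) (hT F θ k)).EB (S F θ (k + 1)) b)
          (Window γ')) ∧
        (∀ b : ℝ, 0 < b → b ≤ γ' → L07 (Mb b) (Window γ') δ θr) ∧
        (∀ b : ℝ, 0 < b → b ≤ γ' → L08 (Mb b) (Window γ') κ (Real.exp 1 * 9 * 64 * K₀ 64 8 ^ 2 * A_B) δ' θr) ∧
        (∀ b : ℝ, 0 < b → b ≤ γ' → L09aff (Mb b) (Window γ')) ∧ (∀ b : ℝ, 0 < b → b ≤ γ' → L09blind (Mb b) (Window γ')) ∧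
        (∀ b : ℝ, 0 < b → b ≤ γ' → L09hom (Mb b) (Window γ')) ∧ (∀ b : ℝ, 0 < b → b ≤ γ' → L09unit (Mb b) (Window γ') κ E₁ cH ω) ∧
        0 < E₁ ∧ 0 ≤ δ + δ' ∧ 0 ≤ θr ∧ θr ≤ θ' ∧ θ' ≤ 1 ∧ 0 ≤ cH ∧ 0 < ω ∧ ρ₀ < 1 ∧
        (δ + δ') * θr ^ k₀ +
            cH * (Real.exp 1 * 9 * 64 * K₀ 64 8 ^ 2 * A_A + Real.exp 1 * 9 * 64 * K₀ 64 8 ^ 2 * A_B) / (1 - ω) ≤ ρ₀ ∧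
        0 ≤ B ∧ (∀ k < k₀, Real.exp 1 * 9 * 64 * K₀ 64 8 ^ 2 * A_A + Real.exp 1 * 9 * 64 * K₀ 64 8 ^ 2 * A_B ≤ B * θr ^ k) ∧
        Real.exp 1 * 9 * 64 * K₀ 64 8 ^ 2 * C3 * cH * ε₁ < (θ' - ω) * (1 - ρ₀) ∧
        -- (ii) the towers' H-layer data in the configuration direction ON THE PLAQUETTE-SMALL TABLES (constant in `(j, Y)`), both runs
        (∀ m, (S F θ k m).AnalyticH (box γ' m)
          (fun _ : (domSys (F.P k) θ.τ9.M (m + 1)).Dom => ofBackgroundC (ιSU N) '' {V : GaugeField (F.P k) 0 (Node00.SU N) | PlaqSmall (a F θ k) V})) ∧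
        (∀ m, (S F θ k m).Bound238 (box γ' m)
          (fun _ : (domSys (F.P k) θ.τ9.M (m + 1)).Dom => ofBackgroundC (ιSU N) '' {V : GaugeField (F.P k) 0 (Node00.SU N) | PlaqSmall (a F θ k) V}) A_A Rd) ∧
        0 ≤ A_A ∧
        A_A * Real.exp (5 * κ + 1) * K₀ 64 8 * 9 * 64 < 1 ∧
        (∀ m, (S F θ (k + 1) m).AnalyticH (box γ' m)
          (fun _ : (domSys (F.P (k + 1)) θ.τ9.M (m + 1)).Dom =>
            ofBackgroundC (ιSU N) '' {V : GaugeField (F.P (k + 1)) 0 (Node00.SU N) | PlaqSmall (a F θ (k + 1)) V})) ∧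
        (∀ m, (S F θ (k + 1) m).Bound238 (box γ' m)
          (fun _ : (domSys (F.P (k + 1)) θ.τ9.M (m + 1)).Dom =>
            ofBackgroundC (ιSU N) '' {V : GaugeField (F.P (k + 1)) 0 (Node00.SU N) | PlaqSmall (a F θ (k + 1)) V}) A_B Rd) ∧
        0 ≤ A_B ∧ A_B * Real.exp (5 * κ + 1) * K₀ 64 8 * 9 * 64 < 1 ∧
        -- the reading's letters dominate the END's
        θ.γ ≤ γ' ∧ (li F θ).κ ≤ κ ∧ θ' ≤ (li F θ).θ₅ ∧
        (Real.exp 1 * 9 * 64 * K₀ 64 8 ^ 2 * (C3 * ε₁) / (1 - ρ₀) * (δ + δ') + B) * (θ' - ω) /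
            (θ' - (ω + Real.exp 1 * 9 * 64 * K₀ 64 8 ^ 2 * (C3 * ε₁) / (1 - ρ₀) * cH)) ≤ (li F θ).C₅) :
    S_N18 (RRec₁₂ (readingOfRecord₁₂ (fun F θ => ReadingData.ofRecordAdm F θ.τ9.M N (S F θ)
      (fun (k j : ℕ) (_ : (domSys (F.P k) θ.τ9.M j).Dom) => ofBackgroundC (ιSU N) '' {V : GaugeField (F.P k) 0 (Node00.SU N) | PlaqSmall (a F θ k) V})
      (gauge F θ) (hg F θ) (fun k => transportRaw F k (avOfRecord F N (k + 1) 0)) (hT F θ) (li F θ)) ℓ₃ ne2 ne1)) := by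
  refine s_N18_readingAdm₁₂_of_envelope_bound238 S _ gauge hg (fun F _ k => transportRaw F k (avOfRecord F N (k + 1) 0))
    hT li ℓ₃ ne2 ne1 fun F θ hP hA k => ?_
  obtain ⟨Op, iO₁, iO₂, Hist, iH₁, iH₂, Mb, act, γ', C3, ε₁, Rd, κ, A_A, A_B, E₁, δ, δ', θr, θ', cH, ω, ρ₀, B, k₀, hrep, hC3, hε₁, hκ, hrate, hKP, hH,
    l01, l02, l03, l07, l08, l09aff, l09blind, l09hom, l09unit, hE₁, hδ, hθ, hθθ', hθ'1, hcH, hω, hρ₀, l10near, hB, l10first, hS, hanA, h238A, hAA,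
    hsmallA, hanB, h238B, hAB, hsmallB, hγ, hℓκ, hℓθ, hℓC⟩ := h F θ hP hA k
  exact ⟨Op, iO₁, iO₂, Hist, iH₁, iH₂, Mb, act, γ', C3, ε₁, Rd, κ, A_A, A_B, E₁, δ, δ', θr, θ', cH, ω, ρ₀, B, k₀, hrep, hC3, hε₁, hκ, hrate, hKP, hH,
    l01, l02, l03, l07, l08, l09aff, l09blind, l09hom, l09unit, hE₁, hδ, hθ, hθθ', hθ'1, hcH, hω, hρ₀, l10near, hB, l10first, hS,
    fun _ _ _ _ => Subset.rfl, hanA, h238A, hAA, hsmallA, fun _ _ _ _ => Subset.rfl, hanB, h238B, hAB, hsmallB, hγ, hℓκ, hℓθ, hℓC⟩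

end Record

end YMDAG.N18.W1Reading

end
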